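import Mathlib

/-!
# MILESTONE (typed, not registered): volume-uniform mass gap of the three-dimensional WILSON-action
# `U(1)^rk` lattice gauge theory at large `β`

Lead c1 of crux `AnchorGap` (stmt-QuantumFields-11141), 2026-08-17. This is the minimal open problem
strictly inside `stub_abelianisation` (see `LEAD-REPORT-c1.md`, items M3–M6): Polyakov's monopole
mechanism for the Wilson (multi-cosine) action. Göpfert–Mack 1982 prove it for the VILLAIN action
(rk = 1); for the Wilson action it is, to our knowledge, unproved. Typed inline over Mathlib so that a
planner can file it verbatim as a statement item (open-problem class). Conventions parallel the crux:
sites `(ℤ/L)³`, links `site × direction`, link variables `θ_ℓ ∈ ℝ^rk` integrated over one period box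
`[-π, π)^{rk}` per link (uniform = Haar on `U(1)^rk`), plaquette angles, action
`β Σ_x Σ_{i<j} Σ_w cos(λ_w · θ_P)` for a finite INTEGER weight family `λ : Fin M → ℤ^rk` spanning `ℝ^rk`
(the weights of a faithful representation restricted to the maximal torus), expectations as ratios
of integrals, spatial translations `σ_n` along `e₀`, `w`-local bounded measurable observables.
-/

open MeasureTheory

/-- **Milestone U1Gap (OPEN).** For every rank `rk`, every finite integer weight family `λ` spanning
`ℝ^rk`, there is `β₀` such that for every `β ≥ β₀` there is a rate `m > 0` with: for every cube side
`w` a constant `C` such that for all `L`, all base points `c` and all measurable `F₁, F₂` bounded by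
`1` depending only on the links based in the cube `c + [0,w]³`, and all `2n < L`,
`|Ex(F₁ · F₂∘σ_n) − Ex F₁ · Ex(F₂∘σ_n)| ≤ C e^{−m n}` in the Wilson-action `U(1)^rk` theory on
`(ℤ/L)³` at coupling `β`. -/
theorem wilsonU1Gap_milestone :
    ∀ (rk M : ℕ) (wt : Fin M → Fin rk → ℤ), (∀ v : Fin rk → ℝ, (∀ j : Fin M, ∑ a : Fin rk, (wt j a : ℝ) * v a = 0) → v = 0) → ∃ β₀ : ℝ, ∀ β : ℝ, β₀ ≤ β → ∃ m : ℝ, 0 < m ∧ ∀ w : ℕ, ∃ C : ℝ, ∀ (L : ℕ) [NeZero L], let X := Fin 3 → ZMod L; let Cfg := X × Fin 3 → Fin rk → ℝ; let box : Set Cfg := Set.pi Set.univ fun _ => Set.pi Set.univ fun _ => Set.Ico (-Real.pi) Real.pi; let pla : Cfg → X → Fin 3 → Fin 3 → Fin rk → ℝ := fun θ x i j a => θ (x, i) a + θ (x + Pi.single i 1, j) a - θ (x + Pi.single j 1, i) a - θ (x, j) a; let act : Cfg → ℝ := fun θ => β * ∑ x : X, ∑ q : {q : Fin 3 × Fin 3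 // q.1 < q.2}, ∑ j : Fin M, Real.cos (∑ a : Fin rk, (wt j a : ℝ) * pla θ x q.1.1 q.1.2 a); let wgt : Cfg → ℝ := fun θ => Real.exp (act θ); let Ex : (Cfg → ℝ) → ℝ := fun F => (∫ θ in box, F θ * wgt θ) / (∫ θ in box, wgt θ); let σ : ℕ → Cfg → Cfg := fun n θ p => θ (p.1 + Pi.single 0 (n : ZMod L), p.2); ∀ (c : X), let Loc := fun F : Cfg → ℝ => Measurable F ∧ (∀ θ, |F θ| ≤ 1) ∧ ∀ θ θ', (∀ p, (∀ i : Fin 3, (p.1 i - c i).val ≤ w) → θ p = θ' p) → F θ = F θ'; ∀ F₁ F₂ : Cfg → ℝ, Loc F₁ → Loc F₂ → ∀ n : ℕ, 2 * n < L → |Ex (fun θ => F₁ θ * F₂ (σ n θ)) - Ex F₁ * Ex (fun θ => F₂ (σ n θ))| ≤ C * Real.exp (-(m * n)) := by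
  sorry
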